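import Mathlib
import HarnessLib
import Summits.HubbardSuperconductivity.HubbardSuperconductivity.Theorems.KLProgrammeKLRegimeSplitGenericV3

/-!
# Route `KLProgramme` — generic children of crux K3 `KLRegimeTwoPointLimit` (stmt-HubbardSuperconductivity-19937), VERSION 4:
# the ENGINE child and the VOLUME-LIMIT child get a REGIME-CONSTANT THRESHOLD (`c ≤ c₃`, `c ≤ c₅`) — defect «Δ16»
# (cell gate-hubbard-kl, seat p1 = C1 lead, g6, 2026-08-26).  Glue `inductionP4` / `k3_inductionP4` / `k3_twoPointLimit_of_childrenP4`
# PROVED for every bundle; the v3 children imply the v4 ones (`engineP4_of_engineP3`, `volumeLimitP2_of_volumeLimitP`), so nothing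
# proved towards a v3 child is lost.

Δ16.  In `EngineP3` (`…SplitGenericV3`) the engine constants `Q` are fixed BEFORE the regime constant `c`, and the conclusion —
the scale-`n` engine output and two-leg step from the history `HistP … n`, for every `n ≤ nScales β + 1` with `IsKLRegime U c (-n)`,
i.e. `U²·n·log 4 ≤ c` — is owed for EVERY `c > 0`.  The single-slice expansion at scale `n` converges only under a smallness
hypothesis that is LINEAR in the sectorised `L¹` size of the scale-`(n-1)` quartic kernel (tree:
`Literature.MathematicalPhysics.QuantumLattice.hubbardSectorKernelNorm_effAction_le`, `θ = e·α·‖Ṽ‖/κ² < 1`; Feldman–Knörrer–Trubowitz,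
overlapping loops, Thm VI), and on the anisotropic sectors that the KL scales force, the size the history certifies for that kernel is
`ε_{n-1} = Klam·(|U| + U²·(n-1))` (`epsCoupling`, (E1) `KernelNormsV4`): at the deepest admissible scale `U²·(n-1) ≈ c/log 4`
INDEPENDENTLY of `U₀`.  Hence the step needs `c ≤ c₃(G,P,Q)`, which `EngineP3` does not offer; `BetaSplitP` (`c ≤ c₀`) and
`CountertermP2` (`c ≤ c₁`) already have their thresholds.  The same applies to `VolumeLimitP` (its volume limits are termwise limits of
the expansion summed over scales).  Repair (this module): `EngineP4` = `EngineP3` with `∃ c₃ > 0, ∀ c, 0 < c → c ≤ c₃ → …` right after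
`∃ Q`; `VolumeLimitP2` = `VolumeLimitP` with `∃ c₅ > 0, ∀ c, 0 < c → c ≤ c₅ → …` right after the four well-formedness hypotheses; the
glue takes `c := min (min c₀ c₁) (min c₃ c₅)`.  K3's conclusion is `∃ c > 0`, so the repair costs nothing downstream.
Children of record at a bundle `Pr` and a volume-limit text `VL`: `EngineP4 Pr W | BetaSplitP Pr W | CountertermP2 Pr W |
VolumeLimitP2 Pr VL W | TwoPointAssemblyP3 Pr VL W`.  Nothing here asserts anything about the Hubbard model.
-/

noncomputable section

namespace Summit.HubbardSuperconductivity.HubbardSuperconductivity.Theorems.KLRegimeSplit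

set_option linter.dupNamespace false -- summit = problem name (single-conjunct summit), D-0017

open Real Finset Filter Literature.MathematicalPhysics.QuantumLattice Literature.Probability.LatticeModels
open Literature.MathematicalPhysics.QuantumLattice.FermiRG
open Summit.HubbardSuperconductivity.HubbardSuperconductivity.Theorems.KLProgrammeLegKernels
open Summit.HubbardSuperconductivity.HubbardSuperconductivity.Theorems.DispersionFlow

/-! ## §1 The two repaired children -/

/-- **Child 3, v4: `EngineP4 Pr W`** — `EngineP3` with a REGIME-CONSTANT THRESHOLD: after the engine constants `Q` there is `c₃ > 0`, and
the scale ladder `n ≤ nScales β + 1` (engine output and two-leg step from the history) is owed only for regime constants `0 < c ≤ c₃`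
(Δ16: the scale-`n` expansion's smallness is linear in `ε_{n-1} = Klam(|U| + U²(n-1))`, which reaches `Klam(|U| + c/log 4)` at the
deepest admissible scale for every `U`).  Everything after `c` is `EngineP3`'s text verbatim. -/
def EngineP4 (Pr : Preds) (W : Set ℝ) : Prop :=
  ∃ G : GeoConsts, G.WF ∧ ∀ P : SplitConsts, P.WF → ∀ R : RenConsts, R.WF2 → ∃ Q : EngConsts, Q.WF ∧ ∃ c₃ : ℝ, 0 < c₃ ∧
    ∀ c : ℝ, 0 < c → c ≤ c₃ →
      ∃ U₀ : ℝ, 0 < U₀ ∧ ∃ L₃ : ℝ → ℝ → ℕ, ∃ M₃ : ℝ → ℝ → ℕ → ℕ,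
        ∀ μ ∈ W, ∀ U : ℝ, 0 < U → U ≤ U₀ → ∀ β : ℝ, klBetaMin ≤ β → β ≤ Real.exp (c / U ^ 2) →
          ∀ K : TrigPolyC4v, Pr.frameOK R U (nScales β) μ K →
            ∀ (L M : ℕ) [NeZero L] [NeZero M], L₃ β U ≤ L → M₃ β U L ≤ M →
              ∀ n : ℕ, n ≤ nScales β + 1 → IsKLRegime U c (-(n : ℤ)) → HistP Pr L M G P Q R β U μ K n →
                Pr.engine L M G P Q β U μ K n ∧ Pr.twoLeg L M G P Q R β U μ K n

/-- **Child 5, v2: `VolumeLimitP2 Pr VL W`** — `VolumeLimitP` with a REGIME-CONSTANT THRESHOLD: after the four constant records there is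
`c₅ > 0`, and the volume-limit predicate of every admissible frame carrying the full tower is owed only for `0 < c ≤ c₅` (Δ16: the
termwise volume limits are limits of the expansion summed over scales, under the same smallness).  Everything after `c` is
`VolumeLimitP`'s text verbatim. -/
def VolumeLimitP2 (Pr : Preds) (VL : VolLimitSlot) (W : Set ℝ) : Prop :=
  ∀ G : GeoConsts, ∀ P : SplitConsts, ∀ Q : EngConsts, ∀ R : RenConsts, G.WF → P.WF → Q.WF → R.WF →
    ∃ c₅ : ℝ, 0 < c₅ ∧ ∀ c : ℝ, 0 < c → c ≤ c₅ → ∃ U₀ : ℝ, 0 < U₀ ∧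
      ∀ μ ∈ W, ∀ U : ℝ, 0 < U → U ≤ U₀ → ∀ β : ℝ, klBetaMin ≤ β → β ≤ Real.exp (c / U ^ 2) →
        ∀ K : TrigPolyC4v, Pr.frameOK R U (nScales β) μ K →
          ∀ (Lstar : ℕ) (Mstar : ℕ → ℕ), TowerP Pr G P Q R β U μ K Lstar Mstar → VL β U μ K Mstar

/-! ## §2 Nothing proved is lost: the v3 children imply the v4 ones -/

/-- `EngineP3 → EngineP4` (take any `c₃`, e.g. `1`, and ignore the bound). -/
theorem engineP4_of_engineP3 {Pr : Preds} {W : Set ℝ} (h : EngineP3 Pr W) : EngineP4 Pr W := by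
  obtain ⟨G, hG, hGP⟩ := h
  refine ⟨G, hG, fun P hP R hR => ?_⟩
  obtain ⟨Q, hQ, hc⟩ := hGP P hP R hR
  exact ⟨Q, hQ, 1, one_pos, fun c hc' _ => hc c hc'⟩

/-- `VolumeLimitP → VolumeLimitP2` (take any `c₅`, e.g. `1`, and ignore the bound). -/
theorem volumeLimitP2_of_volumeLimitP {Pr : Preds} {VL : VolLimitSlot} {W : Set ℝ} (h : VolumeLimitP Pr VL W) :
    VolumeLimitP2 Pr VL W :=
  fun G P Q R hG hP hQ hR => ⟨1, one_pos, fun c hc _ => h G P Q R hG hP hQ hR c hc⟩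

/-! ## §3 The five-child glue, v4 -/

/-- **GLUE, v4** (covariance window `W` receiving `μ - U/2`): `EngineP4`, `BetaSplitP`, `CountertermP2`, `VolumeLimitP2`,
`TwoPointAssemblyP3` on `W` give K3 on the analysis window `KLRegimeTwoPointLimitMu (-1) (-0.15)`.  Order of choices
`G → P → R → Q → (c₀, c₁, c₃, c₅) → c := min (min c₀ c₁) (min c₃ c₅) → U₀` (five `U₀`'s); per `(μ, U, β)`: children 3 + 1 by strong
induction to `n_β` for every admissible frame, child 2's frame, the engine's LAST step at `n_β + 1` on that frame's history, child 5's
volume limits, child 4 — `inductionP3`'s proof verbatim after the four thresholds are met. -/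
theorem inductionP4 {Pr : Preds} {VL : VolLimitSlot} {W : Set ℝ}
    (hW : ∀ μ ∈ Set.Icc (-1 : ℝ) (-0.15), ∀ U : ℝ, 0 < U → U ≤ 1 / 10 → μ - U / 2 ∈ W)
    (h₃ : EngineP4 Pr W) (h₁ : BetaSplitP Pr W) (h₂ : CountertermP2 Pr W) (h₅ : VolumeLimitP2 Pr VL W)
    (h₄ : TwoPointAssemblyP3 Pr VL W) :
    KLRegimeTwoPointLimitMu (-1) (-0.15) := by
  intro a ha
  obtain ⟨G, hG, h₃P⟩ := h₃
  obtain ⟨P, hP, h₁Q⟩ := h₁ G hG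
  obtain ⟨R, hR2, h₂Q⟩ := h₂ G P hG hP
  have hR : R.WF := hR2.wf
  obtain ⟨Q, hQ, c₃, hc₃, h₃c⟩ := h₃P P hP R hR2
  obtain ⟨c₀, hc₀, h₁c⟩ := h₁Q Q hQ
  obtain ⟨c₁, hc₁, h₂c⟩ := h₂Q Q hQ
  obtain ⟨c₅, hc₅, h₅c⟩ := h₅ G P Q R hG hP hQ hR
  set c : ℝ := min (min c₀ c₁) (min c₃ c₅) with hc_def
  have hc : 0 < c := lt_min (lt_min hc₀ hc₁) (lt_min hc₃ hc₅)
  have hcc₀ : c ≤ c₀ := (min_le_left _ _).trans (min_le_left _ _)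
  have hcc₁ : c ≤ c₁ := (min_le_left _ _).trans (min_le_right _ _)
  have hcc₃ : c ≤ c₃ := (min_le_right _ _).trans (min_le_left _ _)
  have hcc₅ : c ≤ c₅ := (min_le_right _ _).trans (min_le_right _ _)
  obtain ⟨U₃, hU₃, L₃, M₃, h₃main⟩ := h₃c c hc hcc₃
  obtain ⟨U₁, hU₁, L₁, M₁, h₁main⟩ := h₁c c hc hcc₀ R hR
  obtain ⟨U₂, hU₂, h₂main⟩ := h₂c c hc hcc₁
  obtain ⟨U₅, hU₅, h₅main⟩ := h₅c c hc hcc₅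
  obtain ⟨U₄, hU₄, h₄main⟩ := h₄ G P Q R hG hP hQ hR c hc
  have hlog : 0 < Real.log klBetaMin := Real.log_pos (by norm_num [klBetaMin])
  set U₀ : ℝ := min (min (min (min U₁ U₂) (min U₃ (min U₄ U₅))) (a / Real.log klBetaMin)) (1 / 10) with hU₀_def
  have hU₀ : 0 < U₀ :=
    lt_min (lt_min (lt_min (lt_min hU₁ hU₂) (lt_min hU₃ (lt_min hU₄ hU₅))) (div_pos ha hlog)) (by norm_num)
  refine ⟨U₀, c, hU₀, hc, ?_⟩
  intro μ hμ U β hU hUle hβa hβc x y σ σ'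
  have hU5' : U ≤ min (min (min U₁ U₂) (min U₃ (min U₄ U₅))) (a / Real.log klBetaMin) := hUle.trans (min_le_left _ _)
  have hU10 : U ≤ 1 / 10 := hUle.trans (min_le_right _ _)
  have hUm : U ≤ min (min U₁ U₂) (min U₃ (min U₄ U₅)) := hU5'.trans (min_le_left _ _)
  have hU1 : U ≤ U₁ := hUm.trans ((min_le_left _ _).trans (min_le_left _ _))
  have hU2 : U ≤ U₂ := hUm.trans ((min_le_left _ _).trans (min_le_right _ _))
  have hU3 : U ≤ U₃ := hUm.trans ((min_le_right _ _).trans (min_le_left _ _))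
  have hU4 : U ≤ U₄ := hUm.trans ((min_le_right _ _).trans ((min_le_right _ _).trans (min_le_left _ _)))
  have hU5 : U ≤ U₅ := hUm.trans ((min_le_right _ _).trans ((min_le_right _ _).trans (min_le_right _ _)))
  have hβmin : klBetaMin ≤ β := klBetaMin_le_of_exp_le hU hU5' (min_le_right _ _) hβa
  have hKL : ∀ n ≤ nScales β + 1, IsKLRegime U c (-(n : ℤ)) := fun n hn =>
    isKLRegime_of_le_nScales_succ hc.le hβmin hβc hn
  -- the covariance potential
  set ν : ℝ := μ - U / 2 with hν_def
  have hν : ν ∈ W := hW μ hμ U hU hU10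
  -- the glued induction (children 3 + 1) up to `n_β` for EVERY admissible frame, beyond the maxed hypothesis thresholds
  have hall : ∀ K : TrigPolyC4v, Pr.frameOK R U (nScales β) ν K →
      ∀ (L M : ℕ) [NeZero L] [NeZero M], max (L₃ β U) (L₁ β U) ≤ L → max (M₃ β U L) (M₁ β U L) ≤ M →
        ∀ n : ℕ, n ≤ nScales β → (∀ j < n, Pr.renorm L M β U ν K R j) →
          Pr.engine L M G P Q β U ν K n ∧ Pr.twoLeg L M G P Q R β U ν K n ∧
            Pr.split L M G P Q β U ν K n := by
    intro K hK L M _ _ hL hM n hn hRn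
    have hL3 : L₃ β U ≤ L := (le_max_left _ _).trans hL
    have hL1 : L₁ β U ≤ L := (le_max_right _ _).trans hL
    have hM3 : M₃ β U L ≤ M := (le_max_left _ _).trans hM
    have hM1 : M₁ β U L ≤ M := (le_max_right _ _).trans hM
    exact Child.allScales (N := nScales β) (KL := fun n => IsKLRegime U c (-(n : ℤ)))
      (B := fun n => Pr.split L M G P Q β U ν K n) (Rn := fun n => Pr.renorm L M β U ν K R n)
      (E := fun n => Pr.engine L M G P Q β U ν K n) (T := fun n => Pr.twoLeg L M G P Q R β U ν K n)
      (fun n hn hkl hyp => h₃main ν hν U hU hU3 β hβmin hβc K hK L M hL3 hM3 n (Nat.le_succ_of_le hn) hkl hyp)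
      (fun n hn hkl hyp hEn hTn => h₁main ν hν U hU hU1 β hβmin hβc K hK L M hL1 hM1 n hn hkl hyp hEn hTn)
      (fun n hn => hKL n (Nat.le_succ_of_le hn)) n hn hRn
  -- child 2: the volume-uniform renormalised admissible frame and its thresholds
  obtain ⟨K, hK, Lc, Mc, hKR⟩ :=
    h₂main ν hν U hU hU2 β hβmin hβc (max (L₃ β U) (L₁ β U)) (fun L => max (M₃ β U L) (M₁ β U L)) hall
  -- the full tower of K beyond the max of all thresholds, including the engine's LAST step `n_β + 1`
  set Lstar : ℕ := max Lc (max (L₃ β U) (L₁ β U)) with hLstar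
  set Mstar : ℕ → ℕ := fun L => max (Mc L) (max (M₃ β U L) (M₁ β U L)) with hMstar
  have htower : TowerP Pr G P Q R β U ν K Lstar Mstar := by
    intro L M _ _ hL hM
    have hLc : Lc ≤ L := (le_max_left _ _).trans hL
    have hLh : max (L₃ β U) (L₁ β U) ≤ L := (le_max_right _ _).trans hL
    have hL3 : L₃ β U ≤ L := (le_max_left _ _).trans hLh
    have hMc : Mc L ≤ M := (le_max_left _ _).trans hM
    have hMh : max (M₃ β U L) (M₁ β U L) ≤ M := (le_max_right _ _).trans hM
    have hM3 : M₃ β U L ≤ M := (le_max_left _ _).trans hMh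
    have hle : ∀ n : ℕ, n ≤ nScales β →
        Pr.renorm L M β U ν K R n ∧ Pr.split L M G P Q β U ν K n ∧
          Pr.engine L M G P Q β U ν K n ∧ Pr.twoLeg L M G P Q R β U ν K n := by
      intro n hn
      have h := hall K hK L M hLh hMh n hn fun j hj => hKR L M hLc hMc j (le_of_lt (lt_of_lt_of_le hj hn))
      exact ⟨hKR L M hLc hMc n hn, h.2.2, h.1, h.2.1⟩
    refine ⟨hle, ?_⟩
    -- the last step: history = the tower at `j ≤ n_β`
    have hhist : HistP Pr L M G P Q R β U ν K (nScales β + 1) := by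
      intro j hj
      have hj' : j ≤ nScales β := Nat.lt_succ_iff.mp hj
      have h := hle j hj'
      exact ⟨h.2.1, h.1, h.2.2.1, h.2.2.2⟩
    exact h₃main ν hν U hU hU3 β hβmin hβc K hK L M hL3 hM3 (nScales β + 1) le_rfl (hKL _ le_rfl) hhist
  -- child 5: termwise volume limits for this frame
  have hVL : VL β U ν K Mstar := h₅main ν hν U hU hU5 β hβmin hβc K hK Lstar Mstar htower
  -- child 4 at the covariance potential; its conclusion is at ν + U/2 = μ
  have hphys : ν + U / 2 = μ := by rw [hν_def]; ring
  have h4 := h₄main ν hν U hU hU4 β hβmin hβc Lstar Mstar ⟨K, hK, htower, hVL⟩ x y σ σ'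
  rwa [hphys] at h4

/-- **GLUE, v4, on the covariance window `klWindowC`**: the five children give K3 on the analysis window. -/
theorem k3_inductionP4 {Pr : Preds} {VL : VolLimitSlot} (h₃ : EngineP4 Pr klWindowC) (h₁ : BetaSplitP Pr klWindowC)
    (h₂ : CountertermP2 Pr klWindowC) (h₅ : VolumeLimitP2 Pr VL klWindowC) (h₄ : TwoPointAssemblyP3 Pr VL klWindowC) :
    KLRegimeTwoPointLimitMu (-1) (-0.15) :=
  inductionP4 (fun _ hμ _ hU hU' => sub_half_mem_klWindowC hμ hU hU') h₃ h₁ h₂ h₅ h₄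

/-- **The crux modulo S0, from the five v4 children** (as `k3_twoPointLimit_of_childrenP3`). -/
theorem k3_twoPointLimit_of_childrenP4 {Pr : Preds} {VL : VolLimitSlot} (h₃ : EngineP4 Pr klWindowC)
    (h₁ : BetaSplitP Pr klWindowC) (h₂ : CountertermP2 Pr klWindowC) (h₅ : VolumeLimitP2 Pr VL klWindowC)
    (h₄ : TwoPointAssemblyP3 Pr VL klWindowC)
    (hS0 : ∀ δ ∈ Set.Icc (0.10 : ℝ) 0.35,
      chemicalPotentialOfDensity (squareDispersion 1 0) (1 - δ) ∈ Set.Icc (-1 : ℝ) (-0.15)) :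
    ∀ a : ℝ, 0 < a → ∃ U₀ c : ℝ, 0 < U₀ ∧ 0 < c ∧ ∀ δ ∈ Set.Icc (0.10 : ℝ) 0.35, ∀ U β : ℝ, 0 < U → U ≤ U₀ →
      Real.exp (a / U) ≤ β → β ≤ Real.exp (c / U ^ 2) → ∀ (x y : Site 2) (σ σ' : Fin 2), ∃ S : ℂ,
        Tendsto (fun L : ℕ => hubbardThermalTwoPoint β U
          (chemicalPotentialOfDensity (squareDispersion 1 0) (1 - δ)) L x y σ σ') atTop (nhds S) := by
  intro a ha
  obtain ⟨U₀, c, hU₀, hc, H⟩ := k3_inductionP4 h₃ h₁ h₂ h₅ h₄ a ha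
  exact ⟨U₀, c, hU₀, hc, fun δ hδ U β hU hUle hβ hβ' x y σ σ' => H _ (hS0 δ hδ) U β hU hUle hβ hβ' x y σ σ'⟩

/-- The v4 glue also serves any MIX of v3/v4 children (via `engineP4_of_engineP3` / `volumeLimitP2_of_volumeLimitP`); in particular the
v3 five-tuple still closes K3 through this module. -/
theorem k3_inductionP4_of_P3 {Pr : Preds} {VL : VolLimitSlot} (h₃ : EngineP3 Pr klWindowC) (h₁ : BetaSplitP Pr klWindowC)
    (h₂ : CountertermP2 Pr klWindowC) (h₅ : VolumeLimitP Pr VL klWindowC) (h₄ : TwoPointAssemblyP3 Pr VL klWindowC) :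
    KLRegimeTwoPointLimitMu (-1) (-0.15) :=
  k3_inductionP4 (engineP4_of_engineP3 h₃) h₁ h₂ (volumeLimitP2_of_volumeLimitP h₅) h₄

end Summit.HubbardSuperconductivity.HubbardSuperconductivity.Theorems.KLRegimeSplit

end
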